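import Summits.QuantumFields.GaugeBoot.OneOverNComponentSums
import HarnessLib

/-!
# Fluctuations of Wilson loops, II: operation sums of concatenated loop sequences (gauge-boot, ADDENDUM 32 part B)

HONEST FRAMING (cell `pub-gaugeboot`, page 1 of every file): the venture produces certified bounds
on lattice expectations at stated coupling, gauge group, dimension and torus size; NOT a mass gap,
NOT a continuum limit, NOT a string tension; NOT Yang–Mills-summit-bearing (barriers
`FixedCouplingUltralocality`, `PerturbativeInvisibility`).  Strong-coupling `SO(N)` lattice gauge theory with free boundary
condition (S. Chatterjee, Comm. Math. Phys. **366** (2019); S. Chatterjee, J. Jafarov, arXiv:1604.04777); nothing about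
four-dimensional continuum Yang–Mills or a mass gap.

## Content

Bookkeeping for the lane's fluctuation programme (centered products of Wilson loop variables are indexed by BLOCKS of loops,
and the loop equations of a concatenation `A ++ B` must be split into the operations inside `A` and inside `B`): a generic
"one-component operation sum" over `w :: t` and over `A ++ B` (`compSum_cons`, `compSum_append`, for an arbitrary local
index family `ι w`, result map `R w q`, summand `Φ w q ·` and values in any additive commutative monoid — the programme works in `ℝ⟦X⟧`), the
tree's operation sums written componentwise with values in a monoid (`sum_posSplitAt_comp`, …, as in
`OneOverNComponentSums` over `ℝ`), and the instances: splittings, twistings and deformations of `A ++ B` are those of `A`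
(with `B` appended) plus those of `B` (with `A` prepended) (`sum_posSplitAt_append`, …, `sum_negDeformAt_append`).

Everything is `[folklore]` (list bookkeeping) given `OneOverNComponentSums`.
-/

noncomputable section

open Finset
open Literature.MathematicalPhysics.QuantumFieldTheory.Chatterjee2019LargeN
open Literature.MathematicalPhysics.QuantumFieldTheory.Chatterjee2019LargeN.Word

namespace Summit.QuantumFields.GaugeBoot

namespace StringDuality

variable {d : ℕ} {M : Type*} [AddCommMonoid M]

/-! ## The generic one-component operation sum -/

/-- One-component operation sums of `w :: t`: the operations on the head plus the operations on the tail (with the head kept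
in front). [folklore] -/
theorem compSum_cons (ι : List (DEdge d) → Type) [∀ w, Fintype (ι w)] (R : (w : List (DEdge d)) → ι w → LoopSeq d)
    (Φ : (w : List (DEdge d)) → ι w → LoopSeq d → M) (w : List (DEdge d)) (t : LoopSeq d) :
    (∑ i : Fin (w :: t).length, ∑ q : ι ((w :: t).get i),
        Φ _ q ((w :: t).take i ++ R ((w :: t).get i) q ++ (w :: t).drop (i + 1))) =
      (∑ q : ι w, Φ w q (R w q ++ t)) +
        ∑ i : Fin t.length, ∑ q : ι (t.get i), Φ _ q (w :: (t.take i ++ R (t.get i) q ++ t.drop (i + 1))) := by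
  refine (Fin.sum_univ_succ (fun i : Fin (t.length + 1) => ∑ q : ι ((w :: t).get i),
    Φ _ q ((w :: t).take i ++ R ((w :: t).get i) q ++ (w :: t).drop (i + 1)))).trans ?_
  rfl

/-- One-component operation sums of `A ++ B`: the operations on the components of `A` (with `B` appended to the result) plus
those on the components of `B` (with `A` prepended). [folklore] -/
theorem compSum_append (ι : List (DEdge d) → Type) [∀ w, Fintype (ι w)] (R : (w : List (DEdge d)) → ι w → LoopSeq d)
    (Φ : (w : List (DEdge d)) → ι w → LoopSeq d → M) (A B : LoopSeq d) :
    (∑ i : Fin (A ++ B).length, ∑ q : ι ((A ++ B).get i),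
        Φ _ q ((A ++ B).take i ++ R ((A ++ B).get i) q ++ (A ++ B).drop (i + 1))) =
      (∑ i : Fin A.length, ∑ q : ι (A.get i), Φ _ q (A.take i ++ R (A.get i) q ++ A.drop (i + 1) ++ B)) +
        ∑ i : Fin B.length, ∑ q : ι (B.get i), Φ _ q (A ++ (B.take i ++ R (B.get i) q ++ B.drop (i + 1))) := by
  induction A generalizing Φ with
  | nil =>
    have h0 : (∑ i : Fin ([] : LoopSeq d).length, ∑ q : ι (([] : LoopSeq d).get i),
        Φ _ q (([] : LoopSeq d).take i ++ R (([] : LoopSeq d).get i) q ++ ([] : LoopSeq d).drop (i + 1) ++ B)) = 0 :=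
      Fin.sum_univ_zero _
    rw [h0, zero_add]
    rfl
  | cons w A ih =>
    have h1 := compSum_cons ι R Φ w (A ++ B)
    have h2 := compSum_cons ι R (fun w' q u => Φ w' q (u ++ B)) w A
    have h3 := ih (fun w' q u => Φ w' q (w :: u))
    refine h1.trans ?_
    rw [h3, h2, add_assoc]
    simp only [List.append_assoc, List.cons_append]

/-! ## The tree's operation sums, componentwise, with values in a monoid -/

section comp

variable {s : LoopSeq d} (hs : ∀ l ∈ s, l ≠ []) (f : LoopSeq d → M)
include hs

/-- Positive splittings, by component (monoid-valued). [cite: Chatterjee2019LargeN, §2.2 (𝕊⁺(s))] -/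
theorem sum_posSplitAt_comp :
    ∑ o : SameIdx s, f (s.posSplitAt o) =
      ∑ i : Fin s.length, ∑ q : {xy : Fin (s.get i).length × Fin (s.get i).length //
          xy.1 ≠ xy.2 ∧ (s.get i).get xy.2 = (s.get i).get xy.1},
        f (s.take i ++ LoopSeq.prune [posSplit₁ (s.get i) q.1.1 q.1.2, posSplit₂ (s.get i) q.1.1 q.1.2] ++ s.drop (i + 1)) := by
  rw [Fintype.sum_sigma]
  refine Finset.sum_congr rfl fun i _ => Finset.sum_congr rfl fun q _ => ?_
  rw [← replaceAt_eq_append hs]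
  rfl

/-- Negative splittings, by component (monoid-valued). [cite: Chatterjee2019LargeN, §2.2 (𝕊⁻(s))] -/
theorem sum_negSplitAt_comp :
    ∑ o : InvIdx s, f (s.negSplitAt o) =
      ∑ i : Fin s.length, ∑ q : {xy : Fin (s.get i).length × Fin (s.get i).length //
          (s.get i).get xy.2 = DEdge.inv ((s.get i).get xy.1)},
        f (s.take i ++ LoopSeq.prune [negSplit₁ (s.get i) q.1.1 q.1.2, negSplit₂ (s.get i) q.1.1 q.1.2] ++ s.drop (i + 1)) := by
  rw [Fintype.sum_sigma]
  refine Finset.sum_congr rfl fun i _ => Finset.sum_congr rfl fun q _ => ?_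
  rw [← replaceAt_eq_append hs]
  rfl

/-- Negative twistings, by component (monoid-valued). [cite: Chatterjee2019LargeN, §2.2 (𝕋⁻(s))] -/
theorem sum_negTwistAt_comp :
    ∑ o : SameIdx s, f (s.negTwistAt o) =
      ∑ i : Fin s.length, ∑ q : {xy : Fin (s.get i).length × Fin (s.get i).length //
          xy.1 ≠ xy.2 ∧ (s.get i).get xy.2 = (s.get i).get xy.1},
        f (s.take i ++ LoopSeq.prune [negTwist (s.get i) q.1.1 q.1.2] ++ s.drop (i + 1)) := by
  rw [Fintype.sum_sigma]
  refine Finset.sum_congr rfl fun i _ => Finset.sum_congr rfl fun q _ => ?_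
  rw [← replaceAt_eq_append hs]
  rfl

/-- Positive twistings, by component (monoid-valued). [cite: Chatterjee2019LargeN, §2.2 (𝕋⁺(s))] -/
theorem sum_posTwistAt_comp :
    ∑ o : InvIdx s, f (s.posTwistAt o) =
      ∑ i : Fin s.length, ∑ q : {xy : Fin (s.get i).length × Fin (s.get i).length //
          (s.get i).get xy.2 = DEdge.inv ((s.get i).get xy.1)},
        f (s.take i ++ LoopSeq.prune [posTwist (s.get i) q.1.1 q.1.2] ++ s.drop (i + 1)) := by
  rw [Fintype.sum_sigma]
  refine Finset.sum_congr rfl fun i _ => Finset.sum_congr rfl fun q _ => ?_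
  rw [← replaceAt_eq_append hs]
  rfl

/-- Positive deformations, by component (monoid-valued). [cite: Chatterjee2019LargeN, §2.2 (𝔻⁺(s))] -/
theorem sum_posDeformAt_comp :
    ∑ o : DeformIdx s, f (s.posDeformAt o) =
      ∑ i : Fin s.length, ∑ y : (Σ x : Fin (s.get i).length, ↥(plaquettesAt ((s.get i).get x))),
        f (s.take i ++ LoopSeq.prune [posDeform (s.get i) y.1 y.2.1] ++ s.drop (i + 1)) := by
  rw [Fintype.sum_sigma]
  refine Finset.sum_congr rfl fun i _ => Finset.sum_congr rfl fun y _ => ?_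
  rw [← replaceAt_eq_append hs]
  rfl

/-- Negative deformations, by component (monoid-valued). [cite: Chatterjee2019LargeN, §2.2 (𝔻⁻(s))] -/
theorem sum_negDeformAt_comp :
    ∑ o : DeformIdx s, f (s.negDeformAt o) =
      ∑ i : Fin s.length, ∑ y : (Σ x : Fin (s.get i).length, ↥(plaquettesAt ((s.get i).get x))),
        f (s.take i ++ LoopSeq.prune [negDeform (s.get i) y.1 y.2.1] ++ s.drop (i + 1)) := by
  rw [Fintype.sum_sigma]
  refine Finset.sum_congr rfl fun i _ => Finset.sum_congr rfl fun y _ => ?_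
  rw [← replaceAt_eq_append hs]
  rfl

end comp

/-! ## Instances: the tree's operation sums of a concatenation -/

section instances

variable {A B : LoopSeq d} (hA : ∀ l ∈ A, l ≠ []) (hB : ∀ l ∈ B, l ≠ [])
include hA hB

omit hA hB in
/-- A concatenation of null-free loop sequences is null-free. [folklore] -/
theorem append_ne_nil_of (hA : ∀ l ∈ A, l ≠ []) (hB : ∀ l ∈ B, l ≠ []) : ∀ l ∈ A ++ B, l ≠ [] := by
  intro l hl
  rcases List.mem_append.mp hl with h | h
  · exact hA l h
  · exact hB l h

/-- Positive splittings of `A ++ B`. [cite: Chatterjee2019LargeN, §2.2 (𝕊⁺(s), componentwise)] -/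
theorem sum_posSplitAt_append (f : LoopSeq d → M) :
    ∑ o : SameIdx (A ++ B), f ((A ++ B).posSplitAt o) =
      (∑ o : SameIdx A, f (A.posSplitAt o ++ B)) + ∑ o : SameIdx B, f (A ++ B.posSplitAt o) := by
  rw [sum_posSplitAt_comp (append_ne_nil_of hA hB) f, sum_posSplitAt_comp hA (fun u => f (u ++ B)),
    sum_posSplitAt_comp hB (fun u => f (A ++ u))]
  exact compSum_append (fun w => {xy : Fin w.length × Fin w.length // xy.1 ≠ xy.2 ∧ w.get xy.2 = w.get xy.1})
    (fun w q => LoopSeq.prune [posSplit₁ w q.1.1 q.1.2, posSplit₂ w q.1.1 q.1.2]) (fun _ _ u => f u) A B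

/-- Negative splittings of `A ++ B`. [cite: Chatterjee2019LargeN, §2.2 (𝕊⁻(s), componentwise)] -/
theorem sum_negSplitAt_append (f : LoopSeq d → M) :
    ∑ o : InvIdx (A ++ B), f ((A ++ B).negSplitAt o) =
      (∑ o : InvIdx A, f (A.negSplitAt o ++ B)) + ∑ o : InvIdx B, f (A ++ B.negSplitAt o) := by
  rw [sum_negSplitAt_comp (append_ne_nil_of hA hB) f, sum_negSplitAt_comp hA (fun u => f (u ++ B)),
    sum_negSplitAt_comp hB (fun u => f (A ++ u))]
  exact compSum_append (fun w => {xy : Fin w.length × Fin w.length // w.get xy.2 = DEdge.inv (w.get xy.1)})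
    (fun w q => LoopSeq.prune [negSplit₁ w q.1.1 q.1.2, negSplit₂ w q.1.1 q.1.2]) (fun _ _ u => f u) A B

/-- Negative twistings of `A ++ B`. [cite: Chatterjee2019LargeN, §2.2 (𝕋⁻(s), componentwise)] -/
theorem sum_negTwistAt_append (f : LoopSeq d → M) :
    ∑ o : SameIdx (A ++ B), f ((A ++ B).negTwistAt o) =
      (∑ o : SameIdx A, f (A.negTwistAt o ++ B)) + ∑ o : SameIdx B, f (A ++ B.negTwistAt o) := by
  rw [sum_negTwistAt_comp (append_ne_nil_of hA hB) f, sum_negTwistAt_comp hA (fun u => f (u ++ B)),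
    sum_negTwistAt_comp hB (fun u => f (A ++ u))]
  exact compSum_append (fun w => {xy : Fin w.length × Fin w.length // xy.1 ≠ xy.2 ∧ w.get xy.2 = w.get xy.1})
    (fun w q => LoopSeq.prune [negTwist w q.1.1 q.1.2]) (fun _ _ u => f u) A B

/-- Positive twistings of `A ++ B`. [cite: Chatterjee2019LargeN, §2.2 (𝕋⁺(s), componentwise)] -/
theorem sum_posTwistAt_append (f : LoopSeq d → M) :
    ∑ o : InvIdx (A ++ B), f ((A ++ B).posTwistAt o) =
      (∑ o : InvIdx A, f (A.posTwistAt o ++ B)) + ∑ o : InvIdx B, f (A ++ B.posTwistAt o) := by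
  rw [sum_posTwistAt_comp (append_ne_nil_of hA hB) f, sum_posTwistAt_comp hA (fun u => f (u ++ B)),
    sum_posTwistAt_comp hB (fun u => f (A ++ u))]
  exact compSum_append (fun w => {xy : Fin w.length × Fin w.length // w.get xy.2 = DEdge.inv (w.get xy.1)})
    (fun w q => LoopSeq.prune [posTwist w q.1.1 q.1.2]) (fun _ _ u => f u) A B

/-- Positive deformations of `A ++ B`. [cite: Chatterjee2019LargeN, §2.2 (𝔻⁺(s), componentwise)] -/
theorem sum_posDeformAt_append (f : LoopSeq d → M) :
    ∑ o : DeformIdx (A ++ B), f ((A ++ B).posDeformAt o) =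
      (∑ o : DeformIdx A, f (A.posDeformAt o ++ B)) + ∑ o : DeformIdx B, f (A ++ B.posDeformAt o) := by
  rw [sum_posDeformAt_comp (append_ne_nil_of hA hB) f, sum_posDeformAt_comp hA (fun u => f (u ++ B)),
    sum_posDeformAt_comp hB (fun u => f (A ++ u))]
  exact compSum_append (fun w => Σ x : Fin w.length, ↥(plaquettesAt (w.get x)))
    (fun w y => LoopSeq.prune [posDeform w y.1 y.2.1]) (fun _ _ u => f u) A B

/-- Negative deformations of `A ++ B`. [cite: Chatterjee2019LargeN, §2.2 (𝔻⁻(s), componentwise)] -/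
theorem sum_negDeformAt_append (f : LoopSeq d → M) :
    ∑ o : DeformIdx (A ++ B), f ((A ++ B).negDeformAt o) =
      (∑ o : DeformIdx A, f (A.negDeformAt o ++ B)) + ∑ o : DeformIdx B, f (A ++ B.negDeformAt o) := by
  rw [sum_negDeformAt_comp (append_ne_nil_of hA hB) f, sum_negDeformAt_comp hA (fun u => f (u ++ B)),
    sum_negDeformAt_comp hB (fun u => f (A ++ u))]
  exact compSum_append (fun w => Σ x : Fin w.length, ↥(plaquettesAt (w.get x)))
    (fun w y => LoopSeq.prune [negDeform w y.1 y.2.1]) (fun _ _ u => f u) A B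

end instances

end StringDuality

end Summit.QuantumFields.GaugeBoot

end
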